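import Summits.Schanuel.Schanuel.Theorems.RootDecomp1KRelLiouvilleCell02

/-!
# RootDecomp1KRelLiouvilleCell — lens 1, generation 34 «RELATIVE-LIOUVILLE CELL of 33364» (RootDecomp1KRelLiouvilleCell.lean fc1db392…, 1985 l) — continuation (RootDecomp1KRelLiouvilleCell03): §4 first half — partial sums of `ℓ₂ = liouvilleNumber 2`, `exists_window_index`, `exists_eval_ne_zero_of_injective`, `norm_sum_sub_sum_le`, `factorial_window_le`, `two_mul_prod_le_exp`

(lens-1 g34 `RootDecomp1KRelLiouvilleCell.lean`, sha256 fc1db392…9176, own farm rc 0 · 0 sorry · axioms std; critic VERDICT STATUS L1658 PORT GO LOW;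
port by census-1 gen 15 in eight parts `RootDecomp1KRelLiouvilleCell01`–`08` — see the PORT NOTE of part 01; `--supports stmt-Schanuel-33364`; rung 0.)
-/

noncomputable section

open Complex IntermediateField Polynomial
open Summit.Schanuel.Schanuel.Theorems.RootDecomp1KHyper
open Summit.Schanuel.Schanuel.Theorems.RootDecomp1KHyper.HyperCell
open Summit.Schanuel.Schanuel.Theorems.RootDecomp1KGeneric

namespace Summit.Schanuel.Schanuel.Theorems.RootDecomp1KRelLiouvilleCell

/-! ## §4  THE INDUCED MEASURE: `MvPolyMeasure θ ⇒ LogPowMeasure (ℓ₂, θ)`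

`ℓ₂ := Σ_{i ≥ 0} 2^{-i!}` is Mathlib's `liouvilleNumber 2`, `s_N := Σ_{i ≤ N} 2^{-i!} = p_N / 2^{N!}` its
partial sums (`LiouvilleNumber.partialSum 2 N`). -/

section InducedMeasure
open LiouvilleNumber
open scoped Nat

/-- The partial sums of `liouvilleNumber 2` are strictly increasing. -/
theorem partialSum_two_strictMono : StrictMono (partialSum 2) :=
  strictMono_nat_of_lt_succ fun n => by
    rw [partialSum_succ]; exact lt_add_of_pos_right _ (by positivity)

/-- `partialSum 2 0 = 1/2`. -/
theorem partialSum_two_zero : partialSum 2 0 = 1 / 2 := by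
  simp [partialSum]

/-- Every partial sum is below `ℓ₂ = liouvilleNumber 2`. -/
theorem partialSum_two_lt_liouvilleNumber (N : ℕ) : partialSum 2 N < liouvilleNumber 2 := by
  have h := partialSum_add_remainder (m := 2) (by norm_num) N
  have hr := remainder_pos (m := 2) (by norm_num) N
  linarith

/-- The partial sums of `ℓ₂` are positive. -/
theorem partialSum_two_pos (N : ℕ) : 0 < partialSum 2 N := by
  have hmono := partialSum_two_strictMono.monotone (Nat.zero_le N)
  rw [partialSum_two_zero] at hmono
  linarith

/-- `ℓ₂ < 3/2`. -/
theorem liouvilleNumber_two_lt : liouvilleNumber 2 < 3 / 2 := by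
  have h := partialSum_add_remainder (m := 2) (by norm_num) 0
  have hr := remainder_lt' 0 (m := 2) (by norm_num)
  rw [partialSum_two_zero] at h
  norm_num [Nat.factorial] at hr
  linarith

/-- `ℓ₂ > 0`. -/
theorem liouvilleNumber_two_pos : 0 < liouvilleNumber 2 :=
  (partialSum_two_pos 0).trans (partialSum_two_lt_liouvilleNumber 0)

/-- Tail bound: `|ℓ₂ − partialSum 2 N| < 2 / 2^{(N+1)!}`. -/
theorem abs_liouvilleNumber_two_sub_partialSum (N : ℕ) :
    |liouvilleNumber 2 - partialSum 2 N| < 2 / 2 ^ (N + 1)! := by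
  have h := partialSum_add_remainder (m := 2) (by norm_num) N
  have hr := remainder_lt' N (m := 2) (by norm_num)
  have hpos := remainder_pos (m := 2) (by norm_num) N
  rw [show liouvilleNumber 2 - partialSum 2 N = remainder 2 N by linarith, abs_of_pos hpos]
  have e : (1 - 1 / (2 : ℝ))⁻¹ * (1 / 2 ^ (N + 1)!) = 2 / 2 ^ (N + 1)! := by
    norm_num [div_eq_mul_inv]
  rw [e] at hr
  exact hr

/-- `partialSum 2 N = p / 2^{N!}` with a natural number `p < 2 · 2^{N!}`. -/
theorem partialSum_two_eq_nat_div (N : ℕ) :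
    ∃ p : ℕ, partialSum 2 N = (p : ℝ) / (2 : ℝ) ^ N ! ∧ p < 2 * 2 ^ N ! := by
  obtain ⟨p, hp⟩ := partialSum_eq_rat (m := 2) (by norm_num) N
  simp only [Nat.cast_ofNat, Nat.cast_pow] at hp
  refine ⟨p, hp, ?_⟩
  have hlt : (p : ℝ) / 2 ^ N ! < 2 := by
    rw [← hp]; linarith [partialSum_two_lt_liouvilleNumber N, liouvilleNumber_two_lt]
  have hpow : (0 : ℝ) < 2 ^ N ! := by positivity
  rw [div_lt_iff₀ hpow] at hlt
  exact_mod_cast hlt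

/-- `(n + d)! ≤ n! · (n + d)^d`. -/
private theorem factorial_add_le_mul_pow (n d : ℕ) : (n + d)! ≤ n ! * (n + d) ^ d := by
  rw [← Nat.factorial_mul_ascFactorial]
  exact Nat.mul_le_mul_left _ (Nat.ascFactorial_le_pow_add n d)

/-- The window index: the least admissible truncation order `N₀ ≥ N_d` with `2^{N₀!} ≥ Y`, together
with the bookkeeping `N₀! ≤ N_d! + (2 log Y + 1)²`, `N₀ ≤ N_d + 2 log Y + 1`. -/
theorem exists_window_index (Y : ℝ) (hY : 1 ≤ Y) (Nd : ℕ) :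
    ∃ N₀ : ℕ, Nd ≤ N₀ ∧ Y ≤ 2 ^ N₀ ! ∧ ((N₀ ! : ℕ) : ℝ) ≤ (Nd ! : ℕ) + (2 * Real.log Y + 1) ^ 2 ∧
      (N₀ : ℝ) ≤ Nd + 2 * Real.log Y + 1 := by
  classical
  have hex : ∃ N : ℕ, Y ≤ 2 ^ N ! := by
    refine ⟨⌈Y⌉₊, (Nat.le_ceil Y).trans ?_⟩
    have h1 : (⌈Y⌉₊ : ℝ) ≤ 2 ^ ⌈Y⌉₊ := by exact_mod_cast (Nat.lt_two_pow_self).le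
    exact h1.trans (pow_le_pow_right₀ (by norm_num) (Nat.self_le_factorial _))
  have hlogY : 0 ≤ Real.log Y := Real.log_nonneg hY
  have hNY : Y ≤ 2 ^ (Nat.find hex) ! := Nat.find_spec hex
  have hfact : (((Nat.find hex) ! : ℕ) : ℝ) ≤ (2 * Real.log Y + 1) ^ 2 ∧
      ((Nat.find hex : ℕ) : ℝ) ≤ 2 * Real.log Y + 1 := by
    rcases hk : Nat.find hex with _ | k
    · simp only [Nat.factorial_zero, Nat.cast_one, CharP.cast_eq_zero]
      constructor <;> nlinarith
    · have hmin : ¬ (Y ≤ 2 ^ k !) := Nat.find_min hex (by rw [hk]; exact Nat.lt_succ_self k)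
      push Not at hmin
      have hkf : ((k ! : ℕ) : ℝ) < 2 * Real.log Y := by
        have h1 : Real.log ((2 : ℝ) ^ k !) < Real.log Y :=
          Real.log_lt_log (by positivity) hmin
        rw [Real.log_pow] at h1
        have h2 := Real.log_two_gt_d9
        nlinarith
      have hkk : (k : ℝ) ≤ (k ! : ℕ) := by exact_mod_cast Nat.self_le_factorial k
      have hk0 : (0 : ℝ) ≤ (k ! : ℕ) := Nat.cast_nonneg _
      constructor
      · rw [Nat.factorial_succ]; push_cast
        nlinarith
      · push_cast; linarith
  refine ⟨max Nd (Nat.find hex), le_max_left _ _, ?_, ?_, ?_⟩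
  · exact hNY.trans (pow_le_pow_right₀ (by norm_num) (Nat.factorial_le (le_max_right _ _)))
  · rcases le_total Nd (Nat.find hex) with h | h
    · rw [max_eq_right h]
      linarith [hfact.1, (Nat.cast_nonneg (Nd !) : (0 : ℝ) ≤ (Nd ! : ℕ))]
    · rw [max_eq_left h]
      nlinarith
  · rcases le_total Nd (Nat.find hex) with h | h
    · rw [max_eq_right h]; linarith [hfact.2, (Nat.cast_nonneg Nd : (0 : ℝ) ≤ Nd)]
    · rw [max_eq_left h]; linarith

/-- Among `K + 1` distinct points one is not a root of a non-zero polynomial of degree `≤ K`. -/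
theorem exists_eval_ne_zero_of_injective {μ : ℂ[X]} (hμ0 : μ ≠ 0) {K : ℕ}
    (hdeg : μ.natDegree ≤ K) (f : Fin (K + 1) → ℂ) (hf : Function.Injective f) :
    ∃ j, μ.eval (f j) ≠ 0 := by
  classical
  by_contra hall
  push Not at hall
  have hsub : Finset.univ.image f ⊆ μ.roots.toFinset := by
    intro x hx
    obtain ⟨j, _, rfl⟩ := Finset.mem_image.mp hx
    rw [Multiset.mem_toFinset, Polynomial.mem_roots hμ0, Polynomial.IsRoot.def]
    exact hall j
  have h1 : (Finset.univ.image f).card = K + 1 := by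
    rw [Finset.card_image_of_injective _ hf, Finset.card_univ, Fintype.card_fin]
  have h2 := Finset.card_le_card hsub
  have h3 := Multiset.toFinset_card_le μ.roots
  have h4 := Polynomial.card_roots' μ
  omega

/-- Tail estimate for `Σ_{k ≤ K} c_k y^k` with `‖c_k‖ ≤ A`, `K ≤ d`, between real points of size `≤ 2`. -/
theorem norm_sum_sub_sum_le {K d : ℕ} (hKd : K ≤ d) (c : Fin (K + 1) → ℂ) {A : ℝ} (hA : 0 ≤ A)
    (hc : ∀ k, ‖c k‖ ≤ A) {a b : ℝ} (ha : |a| ≤ 2) (hb : |b| ≤ 2) :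
    ‖(∑ k : Fin (K + 1), c k * (a : ℂ) ^ (k : ℕ)) - ∑ k : Fin (K + 1), c k * (b : ℂ) ^ (k : ℕ)‖ ≤
      ((d : ℝ) + 1) * A * (d * 2 ^ d) * |a - b| := by
  rw [← Finset.sum_sub_distrib]
  calc ‖∑ k : Fin (K + 1), (c k * (a : ℂ) ^ (k : ℕ) - c k * (b : ℂ) ^ (k : ℕ))‖
      ≤ ∑ k : Fin (K + 1), ‖c k * (a : ℂ) ^ (k : ℕ) - c k * (b : ℂ) ^ (k : ℕ)‖ := norm_sum_le _ _
    _ ≤ ∑ _k : Fin (K + 1), A * ((d : ℝ) * 2 ^ d * |a - b|) := by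
        refine Finset.sum_le_sum fun k _ => ?_
        rw [← mul_sub, norm_mul]
        refine mul_le_mul (hc k) ?_ (norm_nonneg _) hA
        have hcast : ‖(a : ℂ) ^ (k : ℕ) - (b : ℂ) ^ (k : ℕ)‖ = |a ^ (k : ℕ) - b ^ (k : ℕ)| := by
          rw [← Complex.ofReal_pow, ← Complex.ofReal_pow, ← Complex.ofReal_sub, Complex.norm_real,
            Real.norm_eq_abs]
        rw [hcast]
        refine (abs_pow_sub_pow_le (a := a) (b := b) (n := (k : ℕ))).trans ?_
        have hk : ((k : ℕ) : ℝ) ≤ d := by exact_mod_cast (Nat.lt_succ_iff.mp k.2).trans hKd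
        have hmax : max |a| |b| ≤ 2 := max_le ha hb
        have hmax0 : 0 ≤ max |a| |b| := le_max_of_le_left (abs_nonneg a)
        have hpow : max |a| |b| ^ ((k : ℕ) - 1) ≤ (2 : ℝ) ^ d :=
          (pow_le_pow_left₀ hmax0 hmax _).trans (pow_le_pow_right₀ (by norm_num) (by omega))
        have hab0 : 0 ≤ |a - b| := abs_nonneg _
        calc |a - b| * ((k : ℕ) : ℝ) * max |a| |b| ^ ((k : ℕ) - 1)
            ≤ |a - b| * d * 2 ^ d := by gcongr
          _ = (d : ℝ) * 2 ^ d * |a - b| := by ring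
    _ = ((K : ℝ) + 1) * (A * ((d : ℝ) * 2 ^ d * |a - b|)) := by
        rw [Finset.sum_const, Finset.card_univ, Fintype.card_fin, nsmul_eq_mul]; push_cast; ring
    _ ≤ ((d : ℝ) + 1) * (A * ((d : ℝ) * 2 ^ d * |a - b|)) := by
        have hK1 : (K : ℝ) + 1 ≤ d + 1 := by exact_mod_cast Nat.succ_le_succ hKd
        exact mul_le_mul_of_nonneg_right hK1 (by positivity)
    _ = ((d : ℝ) + 1) * A * (d * 2 ^ d) * |a - b| := by ring

/-- Bookkeeping for the window: `N! ≤ A₀ · u^{d+2}`. -/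
theorem factorial_window_le {N N₀ d Nd : ℕ} {Y cY u : ℝ} (hNle : N ≤ N₀ + d)
    (hN₀fact : ((N₀ ! : ℕ) : ℝ) ≤ (Nd ! : ℕ) + (2 * Real.log Y + 1) ^ 2)
    (hN₀le : (N₀ : ℝ) ≤ Nd + 2 * Real.log Y + 1) (hlogY0 : 0 ≤ Real.log Y)
    (hlogY : Real.log Y ≤ cY * u) (hcY0 : 0 ≤ cY) (hu1 : 1 ≤ u) :
    ((N ! : ℕ) : ℝ) ≤
      ((((Nd ! : ℕ) : ℝ) + (2 * cY + 1) ^ 2) * ((Nd : ℝ) + d + 2 * cY + 1) ^ d) * u ^ (d + 2) := by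
  have hu0 : 0 ≤ u := by linarith
  have h1 : N ! ≤ (N₀ + d)! := Nat.factorial_le hNle
  have h2 : (N₀ + d)! ≤ N₀ ! * (N₀ + d) ^ d := factorial_add_le_mul_pow N₀ d
  have h12 : ((N ! : ℕ) : ℝ) ≤ ((N₀ ! : ℕ) : ℝ) * ((N₀ : ℝ) + d) ^ d := by
    have := h1.trans h2; exact_mod_cast this
  refine h12.trans ?_
  have hb1 : 2 * Real.log Y + 1 ≤ (2 * cY + 1) * u := by nlinarith
  have hb1' : 0 ≤ 2 * Real.log Y + 1 := by linarith
  have hfac : ((N₀ ! : ℕ) : ℝ) ≤ (((Nd ! : ℕ) : ℝ) + (2 * cY + 1) ^ 2) * u ^ 2 := by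
    have e1 : (2 * Real.log Y + 1) ^ 2 ≤ ((2 * cY + 1) * u) ^ 2 := pow_le_pow_left₀ hb1' hb1 2
    have e2 : ((Nd ! : ℕ) : ℝ) * 1 ≤ ((Nd ! : ℕ) : ℝ) * u ^ 2 :=
      mul_le_mul_of_nonneg_left (one_le_pow₀ hu1) (Nat.cast_nonneg _)
    calc ((N₀ ! : ℕ) : ℝ) ≤ (Nd ! : ℕ) + (2 * Real.log Y + 1) ^ 2 := hN₀fact
      _ ≤ (Nd ! : ℕ) * u ^ 2 + ((2 * cY + 1) * u) ^ 2 := by linarith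
      _ = (((Nd ! : ℕ) : ℝ) + (2 * cY + 1) ^ 2) * u ^ 2 := by ring
  have hbase : (N₀ : ℝ) + d ≤ ((Nd : ℝ) + d + 2 * cY + 1) * u := by
    have e1 : (N₀ : ℝ) + d ≤ (Nd : ℝ) + d + 2 * Real.log Y + 1 := by linarith
    have e2 : ((Nd : ℝ) + d + 1) * 1 ≤ ((Nd : ℝ) + d + 1) * u :=
      mul_le_mul_of_nonneg_left hu1 (by positivity)
    nlinarith
  have hbase0 : 0 ≤ (N₀ : ℝ) + d := by positivity
  have hpowd : ((N₀ : ℝ) + d) ^ d ≤ (((Nd : ℝ) + d + 2 * cY + 1) * u) ^ d :=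
    pow_le_pow_left₀ hbase0 hbase d
  calc ((N₀ ! : ℕ) : ℝ) * ((N₀ : ℝ) + d) ^ d
      ≤ ((((Nd ! : ℕ) : ℝ) + (2 * cY + 1) ^ 2) * u ^ 2) * ((((Nd : ℝ) + d + 2 * cY + 1) * u) ^ d) :=
        mul_le_mul hfac hpowd (by positivity) (by positivity)
    _ = _ := by rw [mul_pow]; ring

/-- Assembling the final inequality: `2 C₁ L^τ q_d ≤ exp((2C₁ + τ + D A₀ + 1) u^k)`. -/
theorem two_mul_prod_le_exp {C₁ L u A₀ qd Nf D : ℝ} {τ k : ℕ} (hC₁ : 0 < C₁) (hL : 0 < L)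
    (hLu : Real.log L ≤ u) (hu1 : 1 ≤ u) (hk : 1 ≤ k) (hD : 0 ≤ D) (_hA₀ : 0 ≤ A₀) (hqd0 : 0 ≤ qd)
    (hqd : qd ≤ Real.exp (D * Nf)) (hN : Nf ≤ A₀ * u ^ k) :
    2 * C₁ * L ^ τ * qd ≤ Real.exp ((2 * C₁ + τ + D * A₀ + 1) * u ^ k) := by
  have hLτ : L ^ τ ≤ Real.exp (τ * u) := by
    have e1 : L ^ τ = Real.exp (τ * Real.log L) := by
      rw [← Real.log_pow, Real.exp_log (by positivity)]
    rw [e1]; exact Real.exp_le_exp.mpr (mul_le_mul_of_nonneg_left hLu (by positivity))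
  have h2C : 2 * C₁ ≤ Real.exp (2 * C₁) := by linarith [Real.add_one_le_exp (2 * C₁)]
  have hprod : 2 * C₁ * L ^ τ * qd ≤ Real.exp (2 * C₁ + τ * u + D * Nf) := by
    rw [Real.exp_add, Real.exp_add]
    exact mul_le_mul (mul_le_mul h2C hLτ (by positivity) (by positivity)) hqd hqd0 (by positivity)
  refine hprod.trans (Real.exp_le_exp.mpr ?_)
  have hud : u ≤ u ^ k := le_self_pow₀ hu1 (by omega)
  have hud1 : 1 ≤ u ^ k := one_le_pow₀ hu1
  have e1 : 2 * C₁ * 1 ≤ 2 * C₁ * u ^ k := mul_le_mul_of_nonneg_left hud1 (by positivity)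
  have e2 : (τ : ℝ) * u ≤ τ * u ^ k := mul_le_mul_of_nonneg_left hud (by positivity)
  have e3 : D * Nf ≤ D * (A₀ * u ^ k) := mul_le_mul_of_nonneg_left hN hD
  have e4 : 0 ≤ u ^ k := by positivity
  nlinarith

end InducedMeasure

end Summit.Schanuel.Schanuel.Theorems.RootDecomp1KRelLiouvilleCell
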